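import Literature.NumberTheory.Automorphic.GJUnfoldingIntegral
import Literature.Analysis.Complex.HolomorphicParametricIntegral
import Mathlib.Analysis.SpecialFunctions.Pow.Deriv
import HarnessLib

/-!
# The global Godement–Jacquet zeta integral: truncation at `|det| = 1`, domination and holomorphy

Topic `NumberTheory/Automorphic`; namespace `Literature.NumberTheory.Automorphic`. First brick of the
discharge of the named fact `GodementJacquet1972_gjZeta_meromorphic` of `GodementJacquetZetaIntegrals`
(Godement–Jacquet, *Zeta functions of simple algebras*, LNM 260 (1972), §§11–13, Thm. 13.8: the
global zeta integral `Z(Φ, s, φ, φ') = ∫_{GL_n(𝔸_K)} Φ(x) ⟪φ', R(x) φ⟫ |det x|_𝔸^s dν(x)` of a cusp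
form converges for `re s ≫ 0` and continues to a meromorphic function, entire for `n ≥ 2`).

The printed proof (LNM 260, §12–§13; Jacquet, Corvallis (1979), Part 2, §6; for `n = 1` Tate's
thesis, Thm. 4.4.1) splits the integral at `|det x|_𝔸 = 1`:
`Z = Z^{≥1} + Z^{<1}`; the piece `Z^{≥1}` over `{|det x|_𝔸 ≥ 1}` converges for *every* `s`
(it is dominated by its value at any larger real abscissa) and is therefore entire, while Poisson
summation on `M_n(K) ⊂ M_n(𝔸_K)` turns `Z^{<1}(Φ, s)` into `Z^{≥1}(Φ̂, n - s)` of the contragredient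
coefficient plus (for `n = 1`) two polar terms. This file supplies the elementary analytic half of
this scheme, for the tree's honest objects (`gjZetaIntegrand`, `gjZeta`, `adelicAbsDet`,
`schwartzBruhatAdelicMatrix` of `GodementJacquetZetaIntegrals`), with the truncated integrals
realised as `gjZeta μ (ν.restrict S)` for `S = detAtLeastOne n K = {x | 1 ≤ |det x|_𝔸}` (no new
notion of zeta integral is introduced):

* `continuous_of_mem_schwartzBruhatAdelicMatrix`, `continuous_gjZetaIntegrand` — Schwartz–Bruhat
  functions on `M_n(𝔸_K)` are continuous, hence so is the integrand on `GL_n(𝔸_K)` (with the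
  tree's `continuous_glMatrixCoeff`, `continuous_adelicAbsDet_cpow`), and it is a.e. strongly
  measurable for every Borel measure.
* `detAtLeastOne n K` (closed, measurable) and `gjZeta_eq_restrict_add_restrict_compl`:
  `Z = Z^{≥1} + Z^{<1}` on integrable data (Mathlib `integral_add_compl`).
* Domination: `Real.rpow_le_rpow_add_rpow` (`t^σ ≤ t^{σ₁} + t^{σ₂}` for `σ₁ ≤ σ ≤ σ₂`, `t > 0`),
  `norm_gjZetaIntegrand_le_of_mem_detAtLeastOne` (on `{|det| ≥ 1}` the integrand at `s` is bounded
  by the majorant at any `σ ≥ re s`), `integrable_gjZetaIntegrand_of_integrable_norm_mul_rpow`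
  (absolute convergence of `Z(Φ, s)` reduces to that of `∫ ‖Φ‖ |det|^{re s}`, the form in which
  LNM 260, §12 and Jacquet (1979), (6.?) prove it).
* Holomorphy (Literature `differentiableOn_integral_of_dominated`, Cauchy estimates under the
  integral sign): `differentiableOn_gjZeta` — `Z(Φ, ·)` is holomorphic on every open half-plane
  `{re s > x₀}` on which `‖Φ‖ |det|^σ` is integrable for all `σ > x₀`;
  `differentiable_gjZeta_restrict_detAtLeastOne` — under the same hypothesis the truncated
  integral `Z^{≥1}(Φ, ·)` is ENTIRE (Godement–Jacquet's "the integral over `|det x| ≥ 1`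
  converges for all `s`").
* `GodementJacquet1972_gjZeta_meromorphic_zero` — the named fact in rank `n = 0` (the group
  `GL_0(𝔸_K)` is trivial, its Haar measures are finite, `Z` is constant), so that the remaining
  files may assume `1 ≤ n`.

Everything here is proved; no named facts are introduced. Remaining bricks of the discharge (see
the module docstring of `GodementJacquetZetaIntegrals`, "Remaining frontier"): absolute
convergence `∫ ‖Φ‖ |det|^σ < ∞` for `σ ≫ 0` and all `Φ ∈ 𝒮(M_n(𝔸_K))`; the Fourier transform
and Poisson summation on `M_n(𝔸_K)`; the vanishing of the singular terms for cusp forms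
(`n ≥ 2`) and Tate's polar terms (`n = 1`).

## References

* R. Godement, H. Jacquet, *Zeta functions of simple algebras*, LNM 260 (1972), §§11–13,
  Thm. 13.8 [GodementJacquet1972] (not held; acquisition requested).
* H. Jacquet, *Principal `L`-functions of the linear group*, Proc. Sympos. Pure Math. 33 (1979),
  Part 2, §6 [JacquetCorvallis1979].
* J. Tate, *Fourier analysis in number fields and Hecke's zeta-functions*, in Cassels–Fröhlich
  (1967), Ch. XV, §4.4 (the split at `|a| = 1`, Main Theorem 4.4.1) [CasselsFrohlichANT1967].
-/

noncomputable section

open scoped MatrixGroups NNReal InnerProductSpace Classical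
open NumberField NumberField.mixedEmbedding IsDedekindDomain MeasureTheory Complex Set Metric

namespace Literature.NumberTheory.Automorphic

/-! ### Continuity of Schwartz–Bruhat functions and of the integrand -/

section Continuity

variable {n : ℕ} {K : Type} [Field K] [NumberField K]

/-- The archimedean-coordinate map `M_n(𝔸_K) → M_n(ℝ^{r₁} × ℂ^{r₂})` is continuous (entrywise the
continuous ring isomorphism `K_∞ ≅ ℝ^{r₁} × ℂ^{r₂}`, `continuous_ringEquiv_mixedSpace`). [folklore] -/
theorem continuous_adelicMatrixArch : Continuous (adelicMatrixArch n K) := by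
  refine continuous_pi fun i => continuous_pi fun j => ?_
  exact (continuous_ringEquiv_mixedSpace (K := K)).comp
    (continuous_fst.comp ((continuous_apply j).comp (continuous_apply i)))

/-- The finite-coordinate map `M_n(𝔸_K) → M_n(𝔸_K^∞)` is continuous. [folklore] -/
theorem continuous_adelicMatrixFinite : Continuous (adelicMatrixFinite n K) :=
  continuous_id.matrix_map continuous_snd

/-- A factorizable Schwartz–Bruhat function `Φ_∞ ⊗ Φ_f` on `M_n(𝔸_K)` is continuous (`Φ_∞` is a
Schwartz function, `Φ_f` is locally constant). [folklore] -/
theorem IsFactorizableSchwartzBruhat.continuous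
    {Φ : Matrix (Fin n) (Fin n) (AdeleRing (𝓞 K) K) → ℂ} (h : IsFactorizableSchwartzBruhat n K Φ) :
    Continuous Φ := by
  obtain ⟨Φinf, Φfin, hfin, rfl⟩ := h
  exact (Φinf.continuous.comp continuous_adelicMatrixArch).mul
    (hfin.1.continuous.comp continuous_adelicMatrixFinite)

/-- Every element of the Schwartz–Bruhat space `𝒮(M_n(𝔸_K))` (the span of the factorizable
functions) is continuous. [folklore] -/
theorem continuous_of_mem_schwartzBruhatAdelicMatrix
    {Φ : Matrix (Fin n) (Fin n) (AdeleRing (𝓞 K) K) → ℂ} (h : Φ ∈ schwartzBruhatAdelicMatrix n K) :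
    Continuous Φ := by
  induction h using Submodule.span_induction with
  | mem Ψ hΨ => exact IsFactorizableSchwartzBruhat.continuous hΨ
  | zero => exact continuous_const
  | add Ψ₁ Ψ₂ _ _ h₁ h₂ => exact h₁.add h₂
  | smul c Ψ _ h => exact continuous_const.mul h

variable {μ : Measure (AdelicGroupData.gl n K).automorphicQuotient}
  [(AdelicGroupData.gl n K).IsAutomorphicMeasure μ]

/-- The Godement–Jacquet integrand `x ↦ Φ(x) ⟪φ', R(x) φ⟫ |det x|_𝔸^s` is continuous on
`GL_n(𝔸_K)` as soon as `Φ` is continuous there (strong continuity of `R`,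
`continuous_glMatrixCoeff`; `continuous_adelicAbsDet_cpow`). [folklore] -/
theorem continuous_gjZetaIntegrand {Φ : Matrix (Fin n) (Fin n) (AdeleRing (𝓞 K) K) → ℂ}
    (hΦ : Continuous fun x : GL (Fin n) (AdeleRing (𝓞 K) K) =>
      Φ (x : Matrix (Fin n) (Fin n) (AdeleRing (𝓞 K) K)))
    (φ φ' : (AdelicGroupData.gl n K).L2 μ) (s : ℂ) :
    Continuous (gjZetaIntegrand μ Φ φ φ' s) :=
  (hΦ.mul (continuous_glMatrixCoeff φ φ')).mul (continuous_adelicAbsDet_cpow s)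

/-- For `Φ ∈ 𝒮(M_n(𝔸_K))` the integrand is continuous on `GL_n(𝔸_K)`. [folklore] -/
theorem continuous_gjZetaIntegrand_of_mem {Φ : Matrix (Fin n) (Fin n) (AdeleRing (𝓞 K) K) → ℂ}
    (hΦ : Φ ∈ schwartzBruhatAdelicMatrix n K) (φ φ' : (AdelicGroupData.gl n K).L2 μ) (s : ℂ) :
    Continuous (gjZetaIntegrand μ Φ φ φ' s) :=
  continuous_gjZetaIntegrand ((continuous_of_mem_schwartzBruhatAdelicMatrix hΦ).comp
    Units.continuous_val) φ φ' s

/-- The integrand is a.e. strongly measurable for every Borel measure on `GL_n(𝔸_K)` (it is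
continuous and `ℂ` is second countable). [folklore] -/
theorem aestronglyMeasurable_gjZetaIntegrand [MeasurableSpace (GL (Fin n) (AdeleRing (𝓞 K) K))]
    [BorelSpace (GL (Fin n) (AdeleRing (𝓞 K) K))]
    {Φ : Matrix (Fin n) (Fin n) (AdeleRing (𝓞 K) K) → ℂ}
    (hΦ : Continuous fun x : GL (Fin n) (AdeleRing (𝓞 K) K) =>
      Φ (x : Matrix (Fin n) (Fin n) (AdeleRing (𝓞 K) K)))
    (φ φ' : (AdelicGroupData.gl n K).L2 μ) (s : ℂ) (ν : Measure (GL (Fin n) (AdeleRing (𝓞 K) K))) :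
    AEStronglyMeasurable (gjZetaIntegrand μ Φ φ φ' s) ν :=
  (continuous_gjZetaIntegrand hΦ φ φ' s).aestronglyMeasurable

end Continuity

/-! ### The region `|det x|_𝔸 ≥ 1` and the splitting `Z = Z^{≥1} + Z^{<1}` -/

section Region

variable (n : ℕ) (K : Type) [Field K] [NumberField K]

/-- The closed region `{x ∈ GL_n(𝔸_K) | |det x|_𝔸 ≥ 1}` at which Godement–Jacquet (LNM 260, §12,
after Tate, Thm. 4.4.1) split the global zeta integral: `Z = ∫_{|det| ≥ 1} + ∫_{|det| < 1}`. The
truncated integrals are `gjZeta μ (ν.restrict (detAtLeastOne n K))` and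
`gjZeta μ (ν.restrict (detAtLeastOne n K)ᶜ)`. [folklore] -/
def detAtLeastOne : Set (GL (Fin n) (AdeleRing (𝓞 K) K)) :=
  {x | 1 ≤ (adelicAbsDet n K x : ℝ)}

variable {n K}

/-- Membership in `detAtLeastOne`. [folklore] -/
@[simp]
theorem mem_detAtLeastOne_iff (x : GL (Fin n) (AdeleRing (𝓞 K) K)) :
    x ∈ detAtLeastOne n K ↔ 1 ≤ (adelicAbsDet n K x : ℝ) :=
  Iff.rfl

/-- `1 ∈ detAtLeastOne` (`|det 1|_𝔸 = 1`). [folklore] -/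
theorem one_mem_detAtLeastOne : (1 : GL (Fin n) (AdeleRing (𝓞 K) K)) ∈ detAtLeastOne n K := by
  simp [mem_detAtLeastOne_iff, map_one]

/-- The region `{|det| ≥ 1}` is closed (`|det|_𝔸` is continuous). [folklore] -/
theorem isClosed_detAtLeastOne : IsClosed (detAtLeastOne n K) :=
  isClosed_le continuous_const continuous_adelicAbsDet

/-- The region `{|det| ≥ 1}` is Borel measurable. [folklore] -/
theorem measurableSet_detAtLeastOne [MeasurableSpace (GL (Fin n) (AdeleRing (𝓞 K) K))]
    [BorelSpace (GL (Fin n) (AdeleRing (𝓞 K) K))] : MeasurableSet (detAtLeastOne n K) :=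
  isClosed_detAtLeastOne.measurableSet

variable {μ : Measure (AdelicGroupData.gl n K).automorphicQuotient}
  [SMulInvariantMeasure (AdelicGroupData.gl n K).Adelic (AdelicGroupData.gl n K).automorphicQuotient μ]

/-- **`Z = Z^{≥1} + Z^{<1}`**: on integrable data the zeta integral is the sum of its truncations
at `|det x|_𝔸 = 1` (Mathlib `integral_add_compl`). Godement–Jacquet (1972), §12; Tate, Thm. 4.4.1.
[folklore] -/
theorem gjZeta_eq_restrict_add_restrict_compl [MeasurableSpace (GL (Fin n) (AdeleRing (𝓞 K) K))]
    [BorelSpace (GL (Fin n) (AdeleRing (𝓞 K) K))] (ν : Measure (GL (Fin n) (AdeleRing (𝓞 K) K)))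
    {Φ : Matrix (Fin n) (Fin n) (AdeleRing (𝓞 K) K) → ℂ} {φ φ' : (AdelicGroupData.gl n K).L2 μ}
    {s : ℂ} (hint : Integrable (gjZetaIntegrand μ Φ φ φ' s) ν) :
    gjZeta μ ν Φ φ φ' s =
      gjZeta μ (ν.restrict (detAtLeastOne n K)) Φ φ φ' s +
        gjZeta μ (ν.restrict (detAtLeastOne n K)ᶜ) Φ φ φ' s := by
  unfold gjZeta
  exact (integral_add_compl measurableSet_detAtLeastOne hint).symm

end Region

/-! ### Domination of the integrand -/

section Domination

/-- For `t > 0` and `σ₁ ≤ σ ≤ σ₂`: `t^σ ≤ t^{σ₁} + t^{σ₂}` (compare with `t^{σ₂}` if `t ≥ 1` and with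
`t^{σ₁}` if `t ≤ 1`). This is the shape of the local majorants in `s` used to dominate `|det x|^s`
on vertical strips. [folklore] -/
theorem _root_.Real.rpow_le_rpow_add_rpow {t σ σ₁ σ₂ : ℝ} (ht : 0 < t) (h₁ : σ₁ ≤ σ) (h₂ : σ ≤ σ₂) :
    t ^ σ ≤ t ^ σ₁ + t ^ σ₂ := by
  rcases le_or_gt 1 t with h | h
  · calc t ^ σ ≤ t ^ σ₂ := Real.rpow_le_rpow_of_exponent_le h h₂
      _ ≤ t ^ σ₁ + t ^ σ₂ := le_add_of_nonneg_left (Real.rpow_nonneg ht.le _)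
  · calc t ^ σ ≤ t ^ σ₁ := Real.rpow_le_rpow_of_exponent_ge ht h.le h₁
      _ ≤ t ^ σ₁ + t ^ σ₂ := le_add_of_nonneg_right (Real.rpow_nonneg ht.le _)

variable {n : ℕ} {K : Type} [Field K] [NumberField K]
  {μ : Measure (AdelicGroupData.gl n K).automorphicQuotient}
  [SMulInvariantMeasure (AdelicGroupData.gl n K).Adelic (AdelicGroupData.gl n K).automorphicQuotient μ]

/-- **Domination on `{|det| ≥ 1}`**: for `re s ≤ σ` and `|det x|_𝔸 ≥ 1`,
`‖Φ(x) ⟪φ', R(x) φ⟫ |det x|^s‖ ≤ ‖Φ x‖ ‖φ'‖ ‖φ‖ |det x|^σ` — the integrand over `|det x| ≥ 1` at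
`s` is dominated by the majorant at any larger real abscissa (Godement–Jacquet (1972), §12: the
integral over `|det x| ≥ 1` converges for all `s` once it converges for one). [folklore] -/
theorem norm_gjZetaIntegrand_le_of_mem_detAtLeastOne
    (Φ : Matrix (Fin n) (Fin n) (AdeleRing (𝓞 K) K) → ℂ) (φ φ' : (AdelicGroupData.gl n K).L2 μ)
    {s : ℂ} {σ : ℝ} (hs : s.re ≤ σ) {x : GL (Fin n) (AdeleRing (𝓞 K) K)}
    (hx : x ∈ detAtLeastOne n K) :
    ‖gjZetaIntegrand μ Φ φ φ' s x‖ ≤ ‖Φ x‖ * (‖φ'‖ * ‖φ‖) * (adelicAbsDet n K x : ℝ) ^ σ :=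
  (norm_gjZetaIntegrand_le Φ φ φ' s x).trans (mul_le_mul_of_nonneg_left
    (Real.rpow_le_rpow_of_exponent_le hx hs) (mul_nonneg (norm_nonneg _)
      (mul_nonneg (norm_nonneg _) (norm_nonneg _))))

/-- **Domination on a vertical strip**: for `σ₁ ≤ re s ≤ σ₂`,
`‖Φ(x) ⟪φ', R(x) φ⟫ |det x|^s‖ ≤ ‖Φ x‖ ‖φ'‖ ‖φ‖ (|det x|^{σ₁} + |det x|^{σ₂})`. [folklore] -/
theorem norm_gjZetaIntegrand_le_of_re_mem_Icc
    (Φ : Matrix (Fin n) (Fin n) (AdeleRing (𝓞 K) K) → ℂ) (φ φ' : (AdelicGroupData.gl n K).L2 μ)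
    {s : ℂ} {σ₁ σ₂ : ℝ} (h₁ : σ₁ ≤ s.re) (h₂ : s.re ≤ σ₂) (x : GL (Fin n) (AdeleRing (𝓞 K) K)) :
    ‖gjZetaIntegrand μ Φ φ φ' s x‖ ≤
      ‖Φ x‖ * (‖φ'‖ * ‖φ‖) * ((adelicAbsDet n K x : ℝ) ^ σ₁ + (adelicAbsDet n K x : ℝ) ^ σ₂) :=
  (norm_gjZetaIntegrand_le Φ φ φ' s x).trans (mul_le_mul_of_nonneg_left
    (Real.rpow_le_rpow_add_rpow (adelicAbsDet_pos x) h₁ h₂) (mul_nonneg (norm_nonneg _)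
      (mul_nonneg (norm_nonneg _) (norm_nonneg _))))

variable [MeasurableSpace (GL (Fin n) (AdeleRing (𝓞 K) K))]

/-- **Absolute convergence reduces to `∫ ‖Φ‖ |det|^{re s} < ∞`**: if the integrand is a.e. strongly
measurable and `x ↦ ‖Φ x‖ |det x|_𝔸^{re s}` is `ν`-integrable, then the Godement–Jacquet integrand at
`s` is `ν`-integrable (bounded coefficients, `norm_gjZetaIntegrand_le`). This is the form in which
Godement–Jacquet (1972), §12, and Jacquet (1979), §6, prove the convergence of `Z(Φ, s, φ, φ')`.
[folklore] -/
theorem integrable_gjZetaIntegrand_of_integrable_norm_mul_rpow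
    {ν : Measure (GL (Fin n) (AdeleRing (𝓞 K) K))}
    {Φ : Matrix (Fin n) (Fin n) (AdeleRing (𝓞 K) K) → ℂ} {φ φ' : (AdelicGroupData.gl n K).L2 μ}
    {s : ℂ} (hm : AEStronglyMeasurable (gjZetaIntegrand μ Φ φ φ' s) ν)
    (h : Integrable (fun x : GL (Fin n) (AdeleRing (𝓞 K) K) => ‖Φ x‖ * (adelicAbsDet n K x : ℝ) ^ s.re) ν) :
    Integrable (gjZetaIntegrand μ Φ φ φ' s) ν := by
  refine ((h.const_mul (‖φ'‖ * ‖φ‖)).mono' hm (Filter.Eventually.of_forall fun x => ?_))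
  calc ‖gjZetaIntegrand μ Φ φ φ' s x‖
      ≤ ‖Φ x‖ * (‖φ'‖ * ‖φ‖) * (adelicAbsDet n K x : ℝ) ^ s.re := norm_gjZetaIntegrand_le Φ φ φ' s x
    _ = ‖φ'‖ * ‖φ‖ * (‖Φ x‖ * (adelicAbsDet n K x : ℝ) ^ s.re) := by ring

/-- On `{|det| ≥ 1}` the weighted majorants are monotone in the exponent: integrability of
`‖Φ‖ |det|^{σ₀}` on `detAtLeastOne` gives that of `‖Φ‖ |det|^σ` for every `σ ≤ σ₀`. [folklore] -/
theorem integrable_norm_mul_rpow_restrict_detAtLeastOne_of_le [BorelSpace (GL (Fin n) (AdeleRing (𝓞 K) K))]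
    {ν : Measure (GL (Fin n) (AdeleRing (𝓞 K) K))}
    {Φ : Matrix (Fin n) (Fin n) (AdeleRing (𝓞 K) K) → ℂ}
    (hΦm : AEStronglyMeasurable (fun x : GL (Fin n) (AdeleRing (𝓞 K) K) =>
      Φ (x : Matrix (Fin n) (Fin n) (AdeleRing (𝓞 K) K))) (ν.restrict (detAtLeastOne n K)))
    (hdet : AEMeasurable (fun x : GL (Fin n) (AdeleRing (𝓞 K) K) => (adelicAbsDet n K x : ℝ))
      (ν.restrict (detAtLeastOne n K)))
    {σ σ₀ : ℝ} (hσ : σ ≤ σ₀)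
    (h : Integrable (fun x : GL (Fin n) (AdeleRing (𝓞 K) K) => ‖Φ x‖ * (adelicAbsDet n K x : ℝ) ^ σ₀) (ν.restrict (detAtLeastOne n K))) :
    Integrable (fun x : GL (Fin n) (AdeleRing (𝓞 K) K) => ‖Φ x‖ * (adelicAbsDet n K x : ℝ) ^ σ) (ν.restrict (detAtLeastOne n K)) := by
  have hmeas : AEStronglyMeasurable (fun x : GL (Fin n) (AdeleRing (𝓞 K) K) => ‖Φ x‖ * (adelicAbsDet n K x : ℝ) ^ σ)
      (ν.restrict (detAtLeastOne n K)) :=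
    hΦm.norm.mul (hdet.pow_const σ).aestronglyMeasurable
  refine h.mono' hmeas ?_
  filter_upwards [ae_restrict_mem (measurableSet_detAtLeastOne (n := n) (K := K))] with x hx
  rw [Real.norm_of_nonneg (by positivity)]
  exact mul_le_mul_of_nonneg_left (Real.rpow_le_rpow_of_exponent_le hx hσ) (norm_nonneg _)

end Domination

/-! ### Holomorphy of the zeta integral and of its truncation at `|det| ≥ 1` -/

section Holomorphy

variable {n : ℕ} {K : Type} [Field K] [NumberField K]
  {μ : Measure (AdelicGroupData.gl n K).automorphicQuotient}
  [SMulInvariantMeasure (AdelicGroupData.gl n K).Adelic (AdelicGroupData.gl n K).automorphicQuotient μ]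

/-- For fixed `x` the integrand `s ↦ Φ(x) ⟪φ', R(x) φ⟫ |det x|_𝔸^s` is an entire function of `s`
(`|det x|_𝔸 > 0`, Mathlib `DifferentiableAt.const_cpow`). [folklore] -/
theorem differentiable_gjZetaIntegrand_param
    (Φ : Matrix (Fin n) (Fin n) (AdeleRing (𝓞 K) K) → ℂ) (φ φ' : (AdelicGroupData.gl n K).L2 μ)
    (x : GL (Fin n) (AdeleRing (𝓞 K) K)) :
    Differentiable ℂ fun s : ℂ => gjZetaIntegrand μ Φ φ φ' s x := by
  intro s
  have h0 : ((adelicAbsDet n K x : ℝ) : ℂ) ≠ 0 :=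
    Complex.ofReal_ne_zero.2 (adelicAbsDet_pos x).ne'
  unfold gjZetaIntegrand
  exact (differentiableAt_const _).mul (differentiableAt_id.const_cpow (Or.inl h0))

variable [MeasurableSpace (GL (Fin n) (AdeleRing (𝓞 K) K))]

/-- **Holomorphy of `Z(Φ, ·)` on a half-plane of absolute convergence.** If the integrand is a.e.
strongly measurable for every `s` and `x ↦ ‖Φ x‖ |det x|_𝔸^σ` is `ν`-integrable for every real
`σ > x₀`, then `s ↦ Z(Φ, s, φ, φ')` is holomorphic on `{re s > x₀}`: around `s₀` with
`re s₀ - x₀ = 2R` the integrand is dominated on `ball s₀ R` by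
`‖Φ‖ ‖φ'‖ ‖φ‖ (|det|^{re s₀ - R} + |det|^{re s₀ + R})` (Cauchy estimates under the integral sign,
`Literature.Analysis.Complex.differentiableOn_integral_of_dominated`). Godement–Jacquet (1972),
§12; Jacquet (1979), §6 ("the integral converges for `re s` large and represents a holomorphic
function there"). [folklore] -/
theorem differentiableOn_gjZeta {ν : Measure (GL (Fin n) (AdeleRing (𝓞 K) K))}
    {Φ : Matrix (Fin n) (Fin n) (AdeleRing (𝓞 K) K) → ℂ} {φ φ' : (AdelicGroupData.gl n K).L2 μ}
    (hm : ∀ s : ℂ, AEStronglyMeasurable (gjZetaIntegrand μ Φ φ φ' s) ν) {x₀ : ℝ}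
    (h : ∀ σ : ℝ, x₀ < σ → Integrable (fun x : GL (Fin n) (AdeleRing (𝓞 K) K) => ‖Φ x‖ * (adelicAbsDet n K x : ℝ) ^ σ) ν) :
    DifferentiableOn ℂ (gjZeta μ ν Φ φ φ') {s : ℂ | x₀ < s.re} := by
  refine Literature.Analysis.Complex.differentiableOn_integral_of_dominated
    (F := fun s x => gjZetaIntegrand μ Φ φ φ' s x) (fun s _ => hm s)
    (Filter.Eventually.of_forall fun x =>
      (differentiable_gjZetaIntegrand_param Φ φ φ' x).differentiableOn) ?_
  intro s₀ hs₀
  have hs₀' : x₀ < s₀.re := hs₀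
  set R : ℝ := (s₀.re - x₀) / 2 with hR
  have hRpos : 0 < R := by rw [hR]; linarith
  have hre : ∀ p ∈ ball s₀ R, s₀.re - R ≤ p.re ∧ p.re ≤ s₀.re + R := by
    intro p hp
    have h1 : |p.re - s₀.re| < R := by
      have := abs_re_le_norm (p - s₀)
      rw [sub_re] at this
      exact lt_of_le_of_lt this (mem_ball_iff_norm.1 hp)
    constructor <;> linarith [(abs_lt.1 h1).1, (abs_lt.1 h1).2]
  refine ⟨R, hRpos, fun p hp => ?_, fun x : GL (Fin n) (AdeleRing (𝓞 K) K) => ‖Φ x‖ * (‖φ'‖ * ‖φ‖) *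
    ((adelicAbsDet n K x : ℝ) ^ (s₀.re - R) + (adelicAbsDet n K x : ℝ) ^ (s₀.re + R)), ?_, ?_⟩
  · show x₀ < p.re
    have := (hre p hp).1
    rw [hR] at this
    linarith
  · have h1 := h (s₀.re - R) (by rw [hR]; linarith)
    have h2 := h (s₀.re + R) (by linarith)
    have := (h1.add h2).const_mul (‖φ'‖ * ‖φ‖)
    refine this.congr (Filter.Eventually.of_forall fun x => ?_)
    simp only [Pi.add_apply]
    ring
  · exact Filter.Eventually.of_forall fun x p hp =>
      norm_gjZetaIntegrand_le_of_re_mem_Icc Φ φ φ' (hre p hp).1 (hre p hp).2 x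

/-- If `‖Φ‖ |det|^σ` is integrable for *every* real `σ`, then `Z(Φ, ·)` is entire. [folklore] -/
theorem differentiable_gjZeta_of_forall_integrable {ν : Measure (GL (Fin n) (AdeleRing (𝓞 K) K))}
    {Φ : Matrix (Fin n) (Fin n) (AdeleRing (𝓞 K) K) → ℂ} {φ φ' : (AdelicGroupData.gl n K).L2 μ}
    (hm : ∀ s : ℂ, AEStronglyMeasurable (gjZetaIntegrand μ Φ φ φ' s) ν)
    (h : ∀ σ : ℝ, Integrable (fun x : GL (Fin n) (AdeleRing (𝓞 K) K) => ‖Φ x‖ * (adelicAbsDet n K x : ℝ) ^ σ) ν) :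
    Differentiable ℂ (gjZeta μ ν Φ φ φ') := by
  intro s
  have hopen : IsOpen {p : ℂ | s.re - 1 < p.re} := isOpen_lt continuous_const Complex.continuous_re
  exact (differentiableOn_gjZeta hm (x₀ := s.re - 1) (fun σ _ => h σ)).differentiableAt
    (hopen.mem_nhds (by show s.re - 1 < s.re; linarith))

end Holomorphy

section HolomorphyBorel

variable {n : ℕ} {K : Type} [Field K] [NumberField K]
  {μ : Measure (AdelicGroupData.gl n K).automorphicQuotient}
  [(AdelicGroupData.gl n K).IsAutomorphicMeasure μ]
  [MeasurableSpace (GL (Fin n) (AdeleRing (𝓞 K) K))] [BorelSpace (GL (Fin n) (AdeleRing (𝓞 K) K))]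

/-- **The truncated integral `Z^{≥1}(Φ, ·) = ∫_{|det x| ≥ 1} Φ(x) ⟪φ', R(x) φ⟫ |det x|^s dν` is
entire** as soon as `Φ` is continuous on `GL_n(𝔸_K)` and `‖Φ‖ |det|^σ` is `ν`-integrable for all
`σ` beyond some abscissa `x₀` (on `{|det| ≥ 1}` the majorants decrease with `σ`, so they are
integrable there for every real `σ`). Godement–Jacquet (1972), §12–§13 (proof of Thm. 13.8: the
integral over `|det x| ≥ 1` converges for all `s` and is entire); Tate (1967), proof of Thm. 4.4.1.
[cite: GodementJacquet1972, §12–§13 (proof of Thm. 13.8)] -/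
theorem differentiable_gjZeta_restrict_detAtLeastOne
    {ν : Measure (GL (Fin n) (AdeleRing (𝓞 K) K))}
    {Φ : Matrix (Fin n) (Fin n) (AdeleRing (𝓞 K) K) → ℂ}
    (hΦ : Continuous fun x : GL (Fin n) (AdeleRing (𝓞 K) K) =>
      Φ (x : Matrix (Fin n) (Fin n) (AdeleRing (𝓞 K) K)))
    (φ φ' : (AdelicGroupData.gl n K).L2 μ) {x₀ : ℝ}
    (h : ∀ σ : ℝ, x₀ < σ → Integrable (fun x : GL (Fin n) (AdeleRing (𝓞 K) K) => ‖Φ x‖ * (adelicAbsDet n K x : ℝ) ^ σ) ν) :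
    Differentiable ℂ (gjZeta μ (ν.restrict (detAtLeastOne n K)) Φ φ φ') := by
  refine differentiable_gjZeta_of_forall_integrable
    (fun s => (aestronglyMeasurable_gjZetaIntegrand hΦ φ φ' s ν).restrict) fun σ => ?_
  have hσ₀ : x₀ < max σ (x₀ + 1) := lt_of_lt_of_le (by linarith) (le_max_right _ _)
  exact integrable_norm_mul_rpow_restrict_detAtLeastOne_of_le hΦ.aestronglyMeasurable.restrict
    continuous_adelicAbsDet.aemeasurable.restrict (le_max_left σ (x₀ + 1)) (h _ hσ₀).restrict

/-- Under the same hypotheses the full integrand is integrable on the half-plane `{re s > x₀}` and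
`Z(Φ, ·)` is holomorphic there (the two conclusions in the form consumed by the assembly of
`GodementJacquet1972_gjZeta_meromorphic`). [folklore] -/
theorem integrable_and_differentiableOn_gjZeta
    {ν : Measure (GL (Fin n) (AdeleRing (𝓞 K) K))}
    {Φ : Matrix (Fin n) (Fin n) (AdeleRing (𝓞 K) K) → ℂ}
    (hΦ : Continuous fun x : GL (Fin n) (AdeleRing (𝓞 K) K) =>
      Φ (x : Matrix (Fin n) (Fin n) (AdeleRing (𝓞 K) K)))
    (φ φ' : (AdelicGroupData.gl n K).L2 μ) {x₀ : ℝ}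
    (h : ∀ σ : ℝ, x₀ < σ → Integrable (fun x : GL (Fin n) (AdeleRing (𝓞 K) K) => ‖Φ x‖ * (adelicAbsDet n K x : ℝ) ^ σ) ν) :
    (∀ s : ℂ, x₀ < s.re → Integrable (gjZetaIntegrand μ Φ φ φ' s) ν) ∧
      DifferentiableOn ℂ (gjZeta μ ν Φ φ φ') {s : ℂ | x₀ < s.re} :=
  ⟨fun s hs => integrable_gjZetaIntegrand_of_integrable_norm_mul_rpow
      (aestronglyMeasurable_gjZetaIntegrand hΦ φ φ' s ν) (h s.re hs),
    differentiableOn_gjZeta (fun s => aestronglyMeasurable_gjZetaIntegrand hΦ φ φ' s ν) h⟩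

end HolomorphyBorel

/-! ### The rank-zero case of the named fact -/

section Zero

variable {K : Type} [Field K] [NumberField K]
  {μ : Measure (AdelicGroupData.gl 0 K).automorphicQuotient}
  [(AdelicGroupData.gl 0 K).IsAutomorphicMeasure μ]

/-- `GL_0` of any ring is the trivial group. [folklore] -/
theorem generalLinearGroup_fin_zero_eq_one (x : GL (Fin 0) (AdeleRing (𝓞 K) K)) : x = 1 :=
  Units.ext (Subsingleton.elim _ _)

/-- In rank `0` the Godement–Jacquet integrand is the constant `Φ(1) ⟪φ', φ⟫`. [folklore] -/
theorem gjZetaIntegrand_fin_zero (Φ : Matrix (Fin 0) (Fin 0) (AdeleRing (𝓞 K) K) → ℂ)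
    (φ φ' : (AdelicGroupData.gl 0 K).L2 μ) (s : ℂ) (x : GL (Fin 0) (AdeleRing (𝓞 K) K)) :
    gjZetaIntegrand μ Φ φ φ' s x =
      Φ ((1 : GL (Fin 0) (AdeleRing (𝓞 K) K)) : Matrix (Fin 0) (Fin 0) (AdeleRing (𝓞 K) K)) *
        ⟪φ', φ⟫_ℂ := by
  rw [generalLinearGroup_fin_zero_eq_one x, gjZetaIntegrand, glMatrixCoeff_one, map_one]
  simp

/-- **`GodementJacquet1972_gjZeta_meromorphic` in rank `n = 0`.** The group `GL_0(𝔸_K)` is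
trivial, so every Haar measure `ν` on it is finite, the integrand is the constant `Φ(1) ⟪φ', φ⟫`,
`Z(Φ, s, φ, φ') = ν(GL_0) · Φ(1) ⟪φ', φ⟫` for every `s`, and the constant function is the entire
continuation. (Degenerate case, recorded so that the discharge proper may assume `1 ≤ n`.)
[folklore] -/
theorem GodementJacquet1972_gjZeta_meromorphic_zero :
    GodementJacquet1972_gjZeta_meromorphic (n := 0) (K := K) (μ := μ) := by
  intro P Φ _hΦ φ φ' _hφ _hφ' _hKφ _hKφ' _ _ ν _
  haveI : Subsingleton (GL (Fin 0) (AdeleRing (𝓞 K) K)) :=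
    ⟨fun a b => (generalLinearGroup_fin_zero_eq_one a).trans
      (generalLinearGroup_fin_zero_eq_one b).symm⟩
  haveI : Finite (GL (Fin 0) (AdeleRing (𝓞 K) K)) := Finite.of_subsingleton
  haveI : CompactSpace (GL (Fin 0) (AdeleRing (𝓞 K) K)) := Finite.compactSpace
  haveI : IsFiniteMeasure ν := CompactSpace.isFiniteMeasure
  set c : ℂ := Φ ((1 : GL (Fin 0) (AdeleRing (𝓞 K) K)) : Matrix (Fin 0) (Fin 0) (AdeleRing (𝓞 K) K)) *
    ⟪φ', φ⟫_ℂ with hc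
  have hconst : ∀ s : ℂ, gjZetaIntegrand μ Φ φ φ' s = fun _ => c := fun s =>
    funext fun x => gjZetaIntegrand_fin_zero Φ φ φ' s x
  refine ⟨0, fun s _ => ?_, fun _ => (ν Set.univ).toReal • c, fun z => analyticAt_const.meromorphicAt,
    fun _ => differentiable_const _, fun s _ => ?_⟩
  · rw [hconst s]
    exact integrable_const c
  · rw [gjZeta, hconst s, integral_const, measureReal_def]

end Zero

end Literature.NumberTheory.Automorphic
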